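import Summits.QuantumFields.YangMills.Theorems.LuscherReductionDressedRitzPolyakovLiftEuclideanCurrencySlab
import HarnessLib

/-!
# Route `LuscherReduction`, item `DressedRitz` (stmt-QuantumFields-20205), line «polyakovlift» r5 — TRUNCATED SLAB CORRELATORS: the normalised connected
# correlator `corr` is the limit of GENUINELY finite-volume quantities (no vacuum constants): `slabTrunc → corr`

Support module (LEAD prover ym-lead-20205-polyakovlift g0; `--supports stmt-QuantumFields-20205`, helper).  `slabCorr` (`…EuclideanCurrencySlab`,
`…SlabChannelUniversality`) subtracts the VACUUM one-point functions `c_i = ⟨φ, G_iφ⟩` inside a finite slab.  Here the subtraction is done with the slab's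
OWN ratios — the truncated (connected) slab correlator

  `slabTrunc β G t i l M = R_M(G_i, G_l) − R_M(G_i, 1)·R_M(1, G_l)`,   `R_M(f, g) = ⟨fΦ_M, K_β^[t](gΦ_M)⟩ / ⟨Φ_M, K_β^[t]Φ_M⟩`  (`slabRatio`),

a function of free-boundary slab path integrals on `L³ × (2M + t)` ONLY (no `φ`, no `λ₀`), and

* `corr_eq_fk_sub` — the vacuum identity `corr β φ G t i l = ⟨G_iφ, K^[t](G_lφ)⟩/λ₀^t − c_i c_l` (`K^[t]φ = λ₀^tφ`, `‖φ‖ = 1`);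
* ★ `tendsto_slabTrunc` — `slabTrunc β G t i l M → corr β φ G t i l` (`M → ∞`) for every raw vacuum `φ` (three instances of `VacDict.tendsto_feynmanKac`).

So S-UNIV′'s Euclidean form can be fed by estimates on truncated slab correlators, uniformly in the slab length (copy `euclideanChannelUniversality_of_slab`
with `slabTrunc` for `slabCorr` — left to the lane that proves the estimates).  HONEST FRAMING: fixed-lattice functional analysis on the conditional femto rung
R2b1; nothing here bears on infinite volume, the continuum limit or the Clay gap.  References: E. Seiler, LNP 159 §3 [cite: SeilerLNP1982, §3]; Lüscher–Wolff
[cite: LuscherWolff1990].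
-/

set_option autoImplicit false

noncomputable section

open MeasureTheory Filter Topology Real
open Literature.MathematicalPhysics.QuantumFieldTheory (GaugeConfig Site gaugeTransform)
open scoped BigOperators

namespace Summit.QuantumFields.YangMills.Theorems.FemtoTransferGap.PolyakovLift

open Summit.QuantumFields.YangMills.Theorems.FemtoTransferGap
open Summit.QuantumFields.YangMills.Theorems.FemtoTransferGap.VacDict

/-- Slab ratio `R_M(f,g) = ⟨fΦ_M, K_β^[t](gΦ_M)⟩ / ⟨Φ_M, K_β^[t]Φ_M⟩` (a ratio of two free-boundary slab path integrals). [cite: SeilerLNP1982, §3] -/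
def slabRatio {N : ℕ} [NeZero N] (β : ℝ) (f g : GaugeConfig 3 N SU2 → ℝ) (t M : ℕ) : ℝ :=
  l2 (f * slabGround (L := N) β M) ((transferApply β)^[t] (g * slabGround β M)) /
    l2 (slabGround (L := N) β M) ((transferApply β)^[t] (slabGround β M))

/-- **Truncated slab correlator** `R_M(G_i,G_l) − R_M(G_i,1)·R_M(1,G_l)` — no vacuum data. [cite: SeilerLNP1982, §3] -/
def slabTrunc {N : ℕ} [NeZero N] {k : ℕ} (β : ℝ) (G : Fin k → (GaugeConfig 3 N SU2 → ℝ)) (t : ℕ) (i l : Fin k) (M : ℕ) : ℝ :=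
  slabRatio β (G i) (G l) t M - slabRatio β (G i) (fun _ => 1) t M * slabRatio β (fun _ => 1) (G l) t M

/-- The vacuum identity behind truncation: `⟨ins φ G_i, K^[t] ins φ G_l⟩ = ⟨G_iφ, K^[t](G_lφ)⟩ − λ₀^t·c_i·c_l` for a raw vacuum `φ`
(`c_i = ⟨φ, G_iφ⟩`). [folklore] -/
theorem l2_ins_iterate_ins_eq {N : ℕ} [NeZero N] {k : ℕ} {β : ℝ} {φ : GaugeConfig 3 N SU2 → ℝ} (hφ : IsRawVacuum β φ)
    {G : Fin k → (GaugeConfig 3 N SU2 → ℝ)} (hG : ∀ i, IsPhys (G i)) (t : ℕ) (i l : Fin k) :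
    l2 (OpPlat.ins φ (G i)) ((transferApply (L := N) β)^[t] (OpPlat.ins φ (G l))) =
      l2 (G i * φ) ((transferApply β)^[t] (G l * φ)) - levelValue su2Rep N β 0 ^ t * (l2 φ (G i * φ) * l2 φ (G l * φ)) := by
  obtain ⟨Ω, θ, c, hV, hc, hcle⟩ := exists_isVacuum (L := N) β
  have hV' : IsVacuum β ⟨φ, hφ.1⟩ θ := isVacuum_of_isRawVacuum hV hφ
  set Φ : physSubmodule N := ⟨φ, hφ.1⟩ with hΦ
  set Pi : physSubmodule N := ⟨G i * φ, OpPlat.isPhys_mul (hG i) hφ.1⟩ with hPi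
  set Pl : physSubmodule N := ⟨G l * φ, OpPlat.isPhys_mul (hG l) hφ.1⟩ with hPl
  have hinsI : OpPlat.ins φ (G i) = ((Pi - l2 φ (G i * φ) • Φ : physSubmodule N) : GaugeConfig 3 N SU2 → ℝ) := by
    rw [OpPlat.ins_eq]; rfl
  have hinsL : OpPlat.ins φ (G l) = ((Pl - l2 φ (G l * φ) • Φ : physSubmodule N) : GaugeConfig 3 N SU2 → ℝ) := by
    rw [OpPlat.ins_eq]; rfl
  rw [hinsI, hinsL, ← coe_iterate_transferOp, ← l2Form_apply, iterate_sub, iterate_smul, iterate_vac hV' t]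
  simp only [map_sub, map_smul, LinearMap.sub_apply, LinearMap.smul_apply, smul_eq_mul]
  -- the four Gram/form entries
  have h1 : l2Form N Pi ((⇑(transferOp (L := N) β))^[t] Pl) = l2 (G i * φ) ((transferApply β)^[t] (G l * φ)) := by
    rw [l2Form_apply, coe_iterate_transferOp]
  have h2 : l2Form N Pi Φ = l2 φ (G i * φ) := by rw [l2Form_apply, hPi, hΦ]; exact l2_comm _ _
  have h3 : l2Form N Φ ((⇑(transferOp (L := N) β))^[t] Pl) = levelValue su2Rep N β 0 ^ t * l2 φ (G l * φ) := by
    rw [l2Form_apply, coe_iterate_transferOp, hΦ, hPl]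
    exact l2_vac_iterate β hφ.1 (OpPlat.isPhys_mul (hG l) hφ.1) hφ.2.2 t
  have h4 : l2Form N Φ Φ = 1 := by rw [l2Form_apply, hΦ]; exact hφ.2.1
  rw [h1, h2, h3, h4]
  ring

/-- `corr β φ G t i l = ⟨G_iφ, K^[t](G_lφ)⟩/λ₀^t − c_i c_l`. [folklore] -/
theorem corr_eq_fk_sub {N : ℕ} [NeZero N] {k : ℕ} {β : ℝ} (hβ : 0 < β) {φ : GaugeConfig 3 N SU2 → ℝ} (hφ : IsRawVacuum β φ)
    {G : Fin k → (GaugeConfig 3 N SU2 → ℝ)} (hG : ∀ i, IsPhys (G i)) (t : ℕ) (i l : Fin k) :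
    corr β φ G t i l = l2 (G i * φ) ((transferApply β)^[t] (G l * φ)) / levelValue su2Rep N β 0 ^ t - l2 φ (G i * φ) * l2 φ (G l * φ) := by
  have hl0 : levelValue su2Rep N β 0 ^ t ≠ 0 := pow_ne_zero _ (levelValue_su2Rep_pos hβ 0).ne'
  rw [corr, l2_ins_iterate_ins_eq hφ hG, sub_div, mul_div_cancel_left₀ _ hl0]

/-- ★ **Truncated slab correlators converge to `corr`**: `slabTrunc β G t i l M → corr β φ G t i l` as `M → ∞`, for every raw vacuum `φ` (`β > 0`).
[cite: SeilerLNP1982, §3] -/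
theorem tendsto_slabTrunc {N : ℕ} [NeZero N] {k : ℕ} {β : ℝ} (hβ : 0 < β) {φ : GaugeConfig 3 N SU2 → ℝ} (hφ : IsRawVacuum β φ)
    {G : Fin k → (GaugeConfig 3 N SU2 → ℝ)} (hG : ∀ i, IsPhys (G i)) (t : ℕ) (i l : Fin k) :
    Tendsto (slabTrunc β G t i l) atTop (𝓝 (corr β φ G t i l)) := by
  obtain ⟨Ω, θ, c, hV, hc, hcle⟩ := exists_isVacuum (L := N) β
  have hV' : IsVacuum β ⟨φ, hφ.1⟩ θ := isVacuum_of_isRawVacuum hV hφ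
  have hΩ1 : l2Form N ⟨φ, hφ.1⟩ one ≠ 0 := l2Form_one_ne_zero_of_isRawVacuum hV hc hcle hφ
  have h1 : IsPhys (fun _ : GaugeConfig 3 N SU2 => (1 : ℝ)) := isPhys_const 1
  set l0 := levelValue su2Rep N β 0 with hl0
  have hl0pos : 0 < l0 := levelValue_su2Rep_pos hβ 0
  have hl0t : l0 ^ t ≠ 0 := pow_ne_zero _ hl0pos.ne'
  -- the three Feynman–Kac limits
  have hA := tendsto_feynmanKac hV' hβ.le hΩ1 (hG i) (hG l) t
  have hB := tendsto_feynmanKac hV' hβ.le hΩ1 (hG i) h1 t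
  have hC := tendsto_feynmanKac hV' hβ.le hΩ1 h1 (hG l) t
  -- the limit values of the one-point ratios
  have hKφ : (transferApply (L := N) β)^[t] φ = l0 ^ t • φ := by
    have := congrArg (fun x : physSubmodule N => (x : GaugeConfig 3 N SU2 → ℝ)) (iterate_vac hV' t)
    simpa only [coe_iterate_transferOp, Submodule.coe_smul] using this
  have hone_mul : ((fun _ : GaugeConfig 3 N SU2 => (1 : ℝ)) * φ) = φ := by funext U; simp
  have hBval : l2 (G i * φ) ((transferApply β)^[t] ((fun _ : GaugeConfig 3 N SU2 => (1 : ℝ)) * φ)) / l0 ^ t = l2 φ (G i * φ) := by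
    rw [hone_mul, hKφ, l2_smul_right, l2_comm (G i * φ) φ, mul_div_cancel_left₀ _ hl0t]
  have hCval : l2 ((fun _ : GaugeConfig 3 N SU2 => (1 : ℝ)) * φ) ((transferApply β)^[t] (G l * φ)) / l0 ^ t = l2 φ (G l * φ) := by
    rw [hone_mul, l2_vac_iterate β hφ.1 (OpPlat.isPhys_mul (hG l) hφ.1) hφ.2.2 t, mul_div_cancel_left₀ _ hl0t]
  rw [hBval] at hB
  rw [hCval] at hC
  have h := hA.sub (hB.mul hC)
  rw [← corr_eq_fk_sub hβ hφ hG t i l] at h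
  exact h

end Summit.QuantumFields.YangMills.Theorems.FemtoTransferGap.PolyakovLift

end
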